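import Mathlib

/-!
# GirthSidon / ToricSwallowForcesShortRelation — layered walks (support file 1/3)

Support file for item `stmt-ValiantsHypothesis-6538` (`ToricSwallowForcesShortRelation`) of route
GirthSidon (problem `ValiantsHypothesis`).

Setting: a vertex set `W : Finset V` and an edge-index set `A : Finset ι`; edge `i ∈ A` carries its
endpoint multiset `verts i`; `u, v` are *adjacent* when some `i ∈ A` has `verts i = {u, v}`.
A *relation of length `≤ k`* is a pair of multisets `S ≠ T` of indices from `A`, each of size
`≤ k`, with equal endpoint unions `(S.map verts).sum = (T.map verts).sum` (equivalently
`Σ_S (e_a + e_b) = Σ_T (e_a + e_b)` in `ℕ^V`).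

This file: the telescoping identity for alternating endpoint sums along walks
(`alt_telescope`, `two_walks_sum_eq`) and breadth-first balls/layers with layered walks
(`exists_walk_of_mem_layer`).  To keep these support files pure proof files, the balls are not
introduced as definitions: lemmas take a function `ball : ℕ → Finset V` together with its
breadth-first recursion as the hypothesis `hball`; the layer `t` is `ball (t+1) \ ball t` (layer
`0` is `{r}`).  The Moore-type bound built on this is in the companion file `…Moore.lean`.
Everything here is folklore.
-/

set_option linter.dupNamespace false -- single-conjunct summit: `ValiantsHypothesis.ValiantsHypothesis`

namespace Summit.ValiantsHypothesis.ValiantsHypothesis.Theorems.GirthSidonToric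

open Finset

variable {V ι : Type*}

/-- Two-element multisets are equal iff their elements agree up to order. [folklore] -/
theorem pair_eq_pair_iff {a b c d : V} :
    ({a, b} : Multiset V) = {c, d} ↔ (a = c ∧ b = d) ∨ (a = d ∧ b = c) := by
  constructor
  · intro h
    have ha : a ∈ ({c, d} : Multiset V) := by
      rw [← h, Multiset.insert_eq_cons]
      exact Multiset.mem_cons_self _ _
    rw [Multiset.insert_eq_cons, Multiset.mem_cons, Multiset.mem_singleton] at ha
    rcases ha with rfl | rfl
    · rw [Multiset.insert_eq_cons, Multiset.insert_eq_cons, Multiset.cons_inj_right,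
        Multiset.singleton_inj] at h
      exact Or.inl ⟨rfl, h⟩
    · rw [Multiset.pair_comm c a, Multiset.insert_eq_cons, Multiset.insert_eq_cons,
        Multiset.cons_inj_right, Multiset.singleton_inj] at h
      exact Or.inr ⟨rfl, h⟩
  · rintro (⟨rfl, rfl⟩ | ⟨rfl, rfl⟩)
    · rfl
    · exact Multiset.pair_comm a b

/-- Telescoping of the alternating endpoint sum along a walk `P 0, P 1, …, P L`: the endpoints of
the even-position steps and those of the odd-position steps differ by the two ends. [folklore] -/
theorem alt_telescope (P : ℕ → V) (L : ℕ) :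
    (∑ j ∈ (range L).filter (fun j => Even j), ({P j, P (j + 1)} : Multiset V)) +
        (if Even L then {P L} else 0) =
      (∑ j ∈ (range L).filter (fun j => ¬ Even j), ({P j, P (j + 1)} : Multiset V)) + {P 0} +
        (if Even L then 0 else {P L}) := by
  induction L with
  | zero => simp
  | succ L ih =>
    rw [Finset.range_add_one, Finset.filter_insert, Finset.filter_insert]
    by_cases hL : Even L
    · have hL' : ¬ Even (L + 1) := by simpa [Nat.even_add_one] using hL
      simp only [hL, hL', if_true, if_false, not_true_eq_false, add_zero] at ih ⊢
      rw [Finset.sum_insert (by simp), Multiset.insert_eq_cons, ← Multiset.singleton_add]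
      calc _ = (∑ j ∈ (range L).filter (fun j => Even j), ({P j, P (j + 1)} : Multiset V)) +
            {P L} + {P (L + 1)} := by abel
        _ = _ := by rw [ih]
    · have hL' : Even (L + 1) := by simpa [Nat.even_add_one] using hL
      simp only [hL, hL', if_true, if_false, not_false_eq_true, add_zero] at ih ⊢
      rw [Finset.sum_insert (by simp), ih, Multiset.insert_eq_cons, ← Multiset.singleton_add]
      abel

/-- The even-position steps of a walk together with the odd-position steps of a second walk of the
same length and with the same ends have the same endpoint union as the complementary choice.
[folklore] -/
theorem two_walks_sum_eq (verts : ι → Multiset V) (P Q : ℕ → V) (E F : ℕ → ι) (L : ℕ)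
    (hE : ∀ j < L, verts (E j) = {P j, P (j + 1)}) (hF : ∀ j < L, verts (F j) = {Q j, Q (j + 1)})
    (h0 : P 0 = Q 0) (hL : P L = Q L) :
    ((((range L).filter (fun j => Even j)).val.map E +
        ((range L).filter (fun j => ¬ Even j)).val.map F).map verts).sum =
      ((((range L).filter (fun j => ¬ Even j)).val.map E +
        ((range L).filter (fun j => Even j)).val.map F).map verts).sum := by
  have hP := alt_telescope P L
  have hQ := alt_telescope Q L
  simp only [Multiset.map_add, Multiset.sum_add, Multiset.map_map, Function.comp_def]
  rw [← Finset.sum_eq_multiset_sum, ← Finset.sum_eq_multiset_sum, ← Finset.sum_eq_multiset_sum,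
    ← Finset.sum_eq_multiset_sum]
  rw [Finset.sum_congr rfl fun j hj => hE j (mem_range.1 (mem_filter.1 hj).1),
    Finset.sum_congr rfl fun j hj => hF j (mem_range.1 (mem_filter.1 hj).1),
    Finset.sum_congr rfl fun j hj => hE j (mem_range.1 (mem_filter.1 hj).1),
    Finset.sum_congr rfl fun j hj => hF j (mem_range.1 (mem_filter.1 hj).1)]
  rw [h0, hL] at hP
  -- cancel the common boundary terms
  have := congrArg₂ (· + ·) hP hQ.symm
  apply add_right_cancel (b := (if Even L then ({Q L} : Multiset V) else 0) +
    ((if Even L then (0 : Multiset V) else {Q L}) + {Q 0}))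
  calc _ = (∑ j ∈ (range L).filter (fun j => Even j), ({P j, P (j + 1)} : Multiset V)) +
        (if Even L then {Q L} else 0) +
        ((∑ j ∈ (range L).filter (fun j => ¬ Even j), ({Q j, Q (j + 1)} : Multiset V)) + {Q 0} +
        (if Even L then 0 else {Q L})) := by abel
    _ = _ := this
    _ = _ := by abel

/-- Adjacency (some edge of `A` has endpoint multiset `{u, v}`) is symmetric. [folklore] -/
theorem adj_symm {A : Finset ι} {verts : ι → Multiset V} {u v : V}
    (h : ∃ i ∈ A, verts i = {u, v}) : ∃ i ∈ A, verts i = {v, u} := by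
  obtain ⟨i, hi, he⟩ := h
  exact ⟨i, hi, he.trans (Multiset.pair_comm u v)⟩

/-- Adjacency is irreflexive when all endpoint multisets are duplicate-free. [folklore] -/
theorem ne_of_adj {A : Finset ι} {verts : ι → Multiset V} (hA : ∀ i ∈ A, (verts i).Nodup)
    {u v : V} (h : ∃ i ∈ A, verts i = {u, v}) : u ≠ v := by
  obtain ⟨i, hi, he⟩ := h
  have := hA i hi
  rw [he, Multiset.insert_eq_cons, Multiset.nodup_cons] at this
  simpa using this.1

/-- Edge indices along a walk (a choice). [folklore] -/
theorem exists_edges {A : Finset ι} {verts : ι → Multiset V} {t : ℕ} {p : ℕ → V}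
    (hpa : ∀ j < t, ∃ i ∈ A, verts i = {p j, p (j + 1)}) (i₀ : ι) :
    ∃ e : ℕ → ι, ∀ j < t, e j ∈ A ∧ verts (e j) = {p j, p (j + 1)} := by
  classical
  refine ⟨fun j => if h : j < t then (hpa j h).choose else i₀, fun j hj => ?_⟩
  simp only [dif_pos hj]
  exact (hpa j hj).choose_spec

section BFS

/-! ### Breadth-first balls
The hypothesis `hball` of the lemmas below says that `ball : ℕ → Finset V` satisfies the
breadth-first recursion from the root `r` inside `W` for the adjacency induced by `verts` on `A`:
`ball 0 = ∅` and `v ∈ ball (t+1) ↔ v = r ∨ v ∈ ball t ∨ (v ∈ W ∧ v ~ u for some u ∈ ball t)`;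
the layer `t` is `ball (t+1) \ ball t`. -/

variable {A : Finset ι} {verts : ι → Multiset V} {W : Finset V} {r : V} {ball : ℕ → Finset V}

/-- Balls increase. [folklore] -/
theorem ball_subset_succ
    (hball : ball 0 = ∅ ∧ ∀ t v, v ∈ ball (t + 1) ↔
      v = r ∨ v ∈ ball t ∨ (v ∈ W ∧ ∃ u ∈ ball t, ∃ i ∈ A, verts i = {u, v}))
    (t : ℕ) : ball t ⊆ ball (t + 1) := fun _ hv =>
  (hball.2 t _).2 (Or.inr (Or.inl hv))

/-- Balls are monotone in the radius. [folklore] -/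
theorem ball_mono
    (hball : ball 0 = ∅ ∧ ∀ t v, v ∈ ball (t + 1) ↔
      v = r ∨ v ∈ ball t ∨ (v ∈ W ∧ ∃ u ∈ ball t, ∃ i ∈ A, verts i = {u, v}))
    {j t : ℕ} (h : j ≤ t) : ball j ⊆ ball t :=
  monotone_nat_of_le_succ (f := ball) (ball_subset_succ hball) h

/-- Neighbours of `ball t` lie in `ball (t+1)`. [folklore] -/
theorem mem_ball_succ_of_adj
    (hball : ball 0 = ∅ ∧ ∀ t v, v ∈ ball (t + 1) ↔
      v = r ∨ v ∈ ball t ∨ (v ∈ W ∧ ∃ u ∈ ball t, ∃ i ∈ A, verts i = {u, v}))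
    {t : ℕ} {u v : V} (hu : u ∈ ball t) (hv : v ∈ W) (h : ∃ i ∈ A, verts i = {u, v}) :
    v ∈ ball (t + 1) :=
  (hball.2 t v).2 (Or.inr (Or.inr ⟨hv, u, hu, h⟩))

/-- Balls stay inside `W` (when the root is in `W`). [folklore] -/
theorem ball_subset
    (hball : ball 0 = ∅ ∧ ∀ t v, v ∈ ball (t + 1) ↔
      v = r ∨ v ∈ ball t ∨ (v ∈ W ∧ ∃ u ∈ ball t, ∃ i ∈ A, verts i = {u, v}))
    (hr : r ∈ W) (t : ℕ) : ball t ⊆ W := by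
  induction t with
  | zero => simp [hball.1]
  | succ t ih =>
    intro v hv
    rcases (hball.2 t v).1 hv with rfl | h | ⟨h, -⟩
    exacts [hr, ih h, h]

variable [DecidableEq V]

/-- Layer `0` is the root. [folklore] -/
theorem layer_zero
    (hball : ball 0 = ∅ ∧ ∀ t v, v ∈ ball (t + 1) ↔
      v = r ∨ v ∈ ball t ∨ (v ∈ W ∧ ∃ u ∈ ball t, ∃ i ∈ A, verts i = {u, v})) :
    ball (0 + 1) \ ball 0 = {r} := by
  ext v
  rw [mem_sdiff, hball.2 0 v, hball.1]
  simp

/-- Layer `j` lies in every ball of radius `> j`. [folklore] -/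
theorem layer_subset_ball
    (hball : ball 0 = ∅ ∧ ∀ t v, v ∈ ball (t + 1) ↔
      v = r ∨ v ∈ ball t ∨ (v ∈ W ∧ ∃ u ∈ ball t, ∃ i ∈ A, verts i = {u, v}))
    {j t : ℕ} (h : j < t) : ball (j + 1) \ ball j ⊆ ball t :=
  fun _ hv => ball_mono hball h (mem_sdiff.1 hv).1

/-- A vertex of layer `t + 1` has a neighbour in layer `t`. [folklore] -/
theorem exists_adj_of_mem_layer_succ
    (hball : ball 0 = ∅ ∧ ∀ t v, v ∈ ball (t + 1) ↔
      v = r ∨ v ∈ ball t ∨ (v ∈ W ∧ ∃ u ∈ ball t, ∃ i ∈ A, verts i = {u, v}))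
    {t : ℕ} {w : V} (hw : w ∈ ball (t + 1 + 1) \ ball (t + 1)) :
    ∃ u ∈ ball (t + 1) \ ball t, ∃ i ∈ A, verts i = {u, w} := by
  rw [mem_sdiff, hball.2 (t + 1) w] at hw
  obtain ⟨h1, h2⟩ := hw
  rcases h1 with rfl | h | ⟨hwW, u, hu, hadj⟩
  · exact absurd ((hball.2 t _).2 (Or.inl rfl)) h2
  · exact absurd h h2
  · refine ⟨u, mem_sdiff.2 ⟨hu, fun hu' => h2 ?_⟩, hadj⟩
    cases t with
    | zero => simp [hball.1] at hu'
    | succ t => exact mem_ball_succ_of_adj hball hu' hwW hadj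

/-- Every vertex of layer `t` is the end of a layered walk from layer `0`. [folklore] -/
theorem exists_walk_of_mem_layer
    (hball : ball 0 = ∅ ∧ ∀ t v, v ∈ ball (t + 1) ↔
      v = r ∨ v ∈ ball t ∨ (v ∈ W ∧ ∃ u ∈ ball t, ∃ i ∈ A, verts i = {u, v}))
    {t : ℕ} {w : V} (hw : w ∈ ball (t + 1) \ ball t) :
    ∃ p : ℕ → V, p t = w ∧ (∀ j ≤ t, p j ∈ ball (j + 1) \ ball j) ∧
      ∀ j < t, ∃ i ∈ A, verts i = {p j, p (j + 1)} := by
  induction t generalizing w with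
  | zero => exact ⟨fun _ => w, rfl, fun j hj => by rwa [Nat.le_zero.1 hj], fun j hj => by omega⟩
  | succ t ih =>
    obtain ⟨u, hu, hadj⟩ := exists_adj_of_mem_layer_succ hball hw
    obtain ⟨p, hpt, hpl, hpa⟩ := ih hu
    refine ⟨fun j => if j ≤ t then p j else w, by simp, fun j hj => ?_, fun j hj => ?_⟩
    · rcases Nat.lt_or_ge t j with h | h
      · have : j = t + 1 := by omega
        subst this
        simpa using hw
      · simpa [h] using hpl j h
    · rcases Nat.lt_or_ge j t with h | h
      · have h' : j + 1 ≤ t := h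
        simpa [h.le, h'] using hpa j h
      · have : j = t := by omega
        subst this
        simpa [hpt] using hadj

end BFS

end Summit.ValiantsHypothesis.ValiantsHypothesis.Theorems.GirthSidonToric
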